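import Summits.PneNP.PneNP.Theorems.ConvexRankGatesConvexGateBlindExactLiftingCalibration

/-!
# `ExactLifting`, PSD side: weighted sums of squares of junta sums lift to PSD factorisations

Support file for crux `ConvexGateBlind` (stmt-PneNP-10680), line `xor-door-perfect-completeness`, open stub
`stub_exactLifting` (lead c2, 2026-08-16). Companion of `…ExactLiftingSosCalibration.lean` (sub-goal
`exactLifting_sos_calibration`), in the form that concrete certificates use:

* `hasConeFact_shift_of_juntaSos` — if `viol_F(y) − ε = Σ_j μ_j (Σ_a f_{j,a}(y))²` pointwise on `𝔽₂^m`, with weights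
  `μ_j ≥ 0` and every `f_{j,a}` a junta on a set `S_a` with `#S_a ≤ k` (a finite family `a : A` of supports shared by
  all squares), then for every `t ≥ 1` the shifted Index-lift `viol_F(x[w]) − ε` factorises through `PSD_q` alone with
  `q ≤ #A · t^k`: `H_x = Σ_j μ_j Φ_j(x)Φ_j(x)ᵀ`, `Y_w = Ψ(w)Ψ(w)ᵀ` over the coordinates `(a, π)`, `π : S_a → Fin t`,
  `Ψ(w)_{(a,π)} = 1[w|_{S_a} = π]`, `Φ_j(x)_{(a,π)} = f_{j,a}(x|_{S_a} ∘ π extended by 0)`.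
* `exactLifting_exponent_le_juntaSos`, `exactLifting_juntaSos_calibration` — the corresponding calibration of the
  stub's exponent: `φ(d) ≤ k` as soon as some degree-`d` perfectly fooled unsatisfiable `F` has such a certificate.

On XOR ground this is the natural currency: a tree-like Gaussian refutation of width `w` and leaf multiplicities `≤ N`
gives `N·viol_F − 1 = Σ_steps 2(V_A V_B)² + Σ_C (N − n_C) V_C²` with `V_A V_B = ¼(1 − σ_Aχ_A − σ_Bχ_B + σ_Aσ_Bχ_{AΔB})`
a sum of four juntas on `∅, A, B, AΔB` (all of size `≤ w`), so `φ(d) ≤ w`; the sibling file `…ExactLiftingK4.lean`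
instantiates it on the odd-charge Tseitin system of `K₄` (`w = 4`).
-/

set_option linter.dupNamespace false -- `Summit.PneNP.PneNP.…`: summit = sub-problem (D-0017)

namespace Summit.PneNP.PneNP.Theorems.XorDoor

open scoped BigOperators Classical
open Finset Matrix

noncomputable section

/-! ## §1 Lifting a junta sum through the Index gadget -/

/-- Extension by zero of a pointer pattern read through the table: `(x|_S ∘ π)˜(i) = x i (π i)` on `S`, `0` off `S`. -/
theorem junta_read_eq {m t : ℕ} (S : Finset (Fin m)) (f : (Fin m → ZMod 2) → ℝ)
    (hf : ∀ y y' : Fin m → ZMod 2, (∀ i ∈ S, y i = y' i) → f y = f y')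
    (x : Fin m → Fin t → ZMod 2) (w : Fin m → Fin t) :
    f (fun i => if hi : i ∈ S then x i ((fun l : {i // i ∈ S} => w l.1) ⟨i, hi⟩) else 0) =
      f (fun i => x i (w i)) :=
  hf _ _ fun i hi => by simp [hi]

/-- **Lifting identity for a junta sum.** For juntas `f_a` on `S_a`:
`Σ_{(a,π)} f_a(x|_{S_a}∘π)·1[w|_{S_a} = π] = Σ_a f_a(x[w])`. -/
theorem juntaLift_identity {m t : ℕ} {A : Type} [Fintype A] (S : A → Finset (Fin m))
    (f : A → (Fin m → ZMod 2) → ℝ)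
    (hf : ∀ a (y y' : Fin m → ZMod 2), (∀ i ∈ S a, y i = y' i) → f a y = f a y')
    (x : Fin m → Fin t → ZMod 2) (w : Fin m → Fin t) :
    ∑ g : (Σ a : A, ({i // i ∈ S a} → Fin t)),
        f g.1 (fun i => if hi : i ∈ S g.1 then x i (g.2 ⟨i, hi⟩) else 0) *
          (if (∀ i : {i // i ∈ S g.1}, w i.1 = g.2 i) then (1 : ℝ) else 0) =
      ∑ a, f a (fun i => x i (w i)) := by
  rw [Fintype.sum_sigma]
  refine Finset.sum_congr rfl fun a _ => ?_
  rw [Finset.sum_eq_single (fun i : {i // i ∈ S a} => w i.1)]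
  · rw [if_pos (fun _ => rfl), mul_one]
    exact junta_read_eq (S a) (f a) (hf a) x w
  · intro π _ hπ
    have : ¬ ∀ i : {i // i ∈ S a}, w i.1 = π i := fun hall => hπ (funext fun i => (hall i).symm)
    rw [if_neg this, mul_zero]
  · intro h; exact absurd (Finset.mem_univ _) h

/-- The number of lifted coordinates `(a, π)` is at most `#A · t^k` when every `#S_a ≤ k` and `t ≥ 1`. -/
theorem card_juntaLiftIdx_le {m t k : ℕ} (ht : 1 ≤ t) {A : Type} [Fintype A] (S : A → Finset (Fin m))
    (hS : ∀ a, (S a).card ≤ k) :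
    Fintype.card (Σ a : A, ({i // i ∈ S a} → Fin t)) ≤ Fintype.card A * t ^ k := by
  rw [Fintype.card_sigma]
  calc ∑ a, Fintype.card ({i // i ∈ S a} → Fin t) ≤ ∑ _a : A, t ^ k :=
        Finset.sum_le_sum fun a _ => by
          rw [Fintype.card_fun, Fintype.card_fin, Fintype.card_coe]
          exact Nat.pow_le_pow_right ht (hS a)
    _ = Fintype.card A * t ^ k := by rw [Finset.sum_const, Finset.card_univ, smul_eq_mul]

/-! ## §2 Weighted SOS of junta sums ⇒ PSD factorisation of the shifted lift -/

/-- `tr ((μ • vecMulVec a a) * vecMulVec u u) = μ · (a ⬝ᵥ u)²`. -/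
theorem trace_smul_vecMulVec_mul_vecMulVec {n : Type} [Fintype n] (μ : ℝ) (a u : n → ℝ) :
    ((μ • vecMulVec a a) * vecMulVec u u).trace = μ * (a ⬝ᵥ u) ^ 2 := by
  rw [Matrix.smul_mul, trace_smul, mul_vecMulVec, vecMulVec_mulVec, trace_vecMulVec, op_smul_eq_smul,
    smul_dotProduct, smul_eq_mul, smul_eq_mul, sq]

/-- **Weighted SOS of junta sums lifts to a PSD factorisation.** If
`viol_F(y) − ε = Σ_j μ_j (Σ_a f_{j,a}(y))²` on `𝔽₂^m` with `μ_j ≥ 0` and every `f_{j,a}` a junta on `S_a`, `#S_a ≤ k`,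
then for `t ≥ 1` the shifted Index-lift has a `(PSD_q ⊕ ℝ^0)`-factorisation with `q ≤ #A · t^k`. -/
theorem hasConeFact_shift_of_juntaSos {m k t : ℕ} (ht : 1 ≤ t) (F : Finset (Pool m)) {ε : ℝ}
    {J A : Type} [Fintype J] [Fintype A] (μ : J → ℝ) (hμ : ∀ j, 0 ≤ μ j)
    (S : A → Finset (Fin m)) (hS : ∀ a, (S a).card ≤ k)
    (f : J → A → (Fin m → ZMod 2) → ℝ)
    (hf : ∀ j a (y y' : Fin m → ZMod 2), (∀ i ∈ S a, y i = y' i) → f j a y = f j a y')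
    (hcert : ∀ y : Fin m → ZMod 2, (viol F y : ℝ) - ε = ∑ j, μ j * (∑ a, f j a y) ^ 2) :
    ∃ q : ℕ, q ≤ Fintype.card A * t ^ k ∧
      HasConeFact (fun (x : Fin m → Fin t → ZMod 2) (w : Fin m → Fin t) =>
        (viol F (fun i => x i (w i)) : ℝ) - ε) q 0 := by
  -- lifted index set, its size, and an enumeration
  let L : Type := Σ a : A, ({i // i ∈ S a} → Fin t)
  let q : ℕ := Fintype.card L
  let eL : L ≃ Fin q := Fintype.equivFin L
  -- the table-side vectors `Φ_j(x)` and the pointer-side vector `Ψ(w)`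
  let Φ : J → (Fin m → Fin t → ZMod 2) → L → ℝ := fun j x g =>
    f j g.1 (fun i => if hi : i ∈ S g.1 then x i (g.2 ⟨i, hi⟩) else 0)
  let Ψ : (Fin m → Fin t) → L → ℝ := fun w g => if (∀ i : {i // i ∈ S g.1}, w i.1 = g.2 i) then (1 : ℝ) else 0
  -- factors, transported to `Fin q`
  let a : J → (Fin m → Fin t → ZMod 2) → Fin q → ℝ := fun j x l => Φ j x (eL.symm l)
  let u : (Fin m → Fin t) → Fin q → ℝ := fun w l => Ψ w (eL.symm l)
  let H : (Fin m → Fin t → ZMod 2) → Matrix (Fin q) (Fin q) ℝ := fun x => ∑ j, μ j • vecMulVec (a j x) (a j x)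
  let Y : (Fin m → Fin t) → Matrix (Fin q) (Fin q) ℝ := fun w => vecMulVec (u w) (u w)
  have hdot : ∀ j x w, a j x ⬝ᵥ u w = ∑ a', f j a' (fun i => x i (w i)) := by
    intro j x w
    rw [← juntaLift_identity S (f j) (hf j) x w, dotProduct, ← eL.symm.sum_comp (fun g => Φ j x g * Ψ w g)]
  refine ⟨q, card_juntaLiftIdx_le ht S hS, H, Y, (fun _ => Fin.elim0), (fun l => Fin.elim0 l), fun x => ?_,
    fun w => ?_, fun _ l => Fin.elim0 l, fun l => Fin.elim0 l, fun x w => ?_⟩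
  · exact posSemidef_sum _ fun j _ =>
      (by simpa using posSemidef_vecMulVec_self_star (a j x) : (vecMulVec (a j x) (a j x)).PosSemidef).smul (hμ j)
  · simpa using posSemidef_vecMulVec_self_star (u w)
  · rw [Finset.univ_eq_empty (α := Fin 0), Finset.sum_empty, add_zero]
    show (viol F (fun i => x i (w i)) : ℝ) - ε = ((∑ j, μ j • vecMulVec (a j x) (a j x)) * vecMulVec (u w) (u w)).trace
    rw [hcert, Finset.sum_mul, trace_sum]
    refine Finset.sum_congr rfl fun j _ => ?_
    rw [trace_smul_vecMulVec_mul_vecMulVec, hdot]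

/-! ## §3 The calibration in junta-sum form -/

/-- **Calibration (junta-sum SOS form).** Let `φ` be an exponent function as in `ExactLifting`. If some degree-`d`
perfectly fooled unsatisfiable `F` has a certificate `viol_F − ε = Σ_j μ_j (Σ_a f_{j,a})²` (`ε > 0`, `μ ≥ 0`, each
`f_{j,a}` a junta on `S_a`, `#S_a ≤ k`), then `φ(d) ≤ k`. -/
theorem exactLifting_exponent_le_juntaSos (φ : ℕ → ℕ)
    (hφ : ∀ (m d : ℕ) (F : Finset (Pool m)),
      (¬ ∃ y : Fin m → ZMod 2, ∀ e ∈ F, Sat y e) → HasPerfectPseudoExp d F →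
      ∃ T : ℕ, ∀ (t : ℕ) (ε : ℝ), T ≤ t → 0 < ε → ∀ q r : ℕ,
        HasConeFact (fun (x : Fin m → Fin t → ZMod 2) (w : Fin m → Fin t) =>
          (viol F (fun i => x i (w i)) : ℝ) - ε) q r →
        t ^ φ d ≤ q + r)
    {m d k : ℕ} (F : Finset (Pool m)) (hunsat : ¬ ∃ y : Fin m → ZMod 2, ∀ e ∈ F, Sat y e)
    (hE : HasPerfectPseudoExp d F) {ε : ℝ} (hε : 0 < ε)
    {J A : Type} [Fintype J] [Fintype A] (μ : J → ℝ) (hμ : ∀ j, 0 ≤ μ j)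
    (S : A → Finset (Fin m)) (hS : ∀ a, (S a).card ≤ k)
    (f : J → A → (Fin m → ZMod 2) → ℝ)
    (hf : ∀ j a (y y' : Fin m → ZMod 2), (∀ i ∈ S a, y i = y' i) → f j a y = f j a y')
    (hcert : ∀ y : Fin m → ZMod 2, (viol F y : ℝ) - ε = ∑ j, μ j * (∑ a, f j a y) ^ 2) :
    φ d ≤ k := by
  obtain ⟨T, hT⟩ := hφ m d F hunsat hE
  refine exponent_le_of_pow_le (C := Fintype.card A) (T := max T 1) fun t ht => ?_
  have hT' : T ≤ t := le_trans (le_max_left _ _) ht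
  have ht1 : 1 ≤ t := le_trans (le_max_right _ _) ht
  obtain ⟨q, hq, hfact⟩ := hasConeFact_shift_of_juntaSos ht1 F μ hμ S hS f hf hcert
  have h := hT t ε hT' hε q 0 hfact
  calc t ^ φ d ≤ q + 0 := h
    _ ≤ Fintype.card A * t ^ k := by rw [add_zero]; exact hq

/-- **Calibration (junta-sum SOS form), packaged against the stub.** `ExactLifting` implies: for every `d, k`, if
some degree-`d` perfectly fooled unsatisfiable system admits a certificate `viol_F − ε = Σ_j μ_j (Σ_a f_{j,a})²` with
`ε > 0`, weights `μ ≥ 0` and juntas `f_{j,a}` on sets of size `≤ k`, then the stub's exponent has `φ(d) ≤ k`. -/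
theorem exactLifting_juntaSos_calibration : ExactLifting →
    ∃ φ : ℕ → ℕ, (∀ K : ℕ, ∃ d : ℕ, K ≤ φ d) ∧
      ∀ (m d k : ℕ) (F : Finset (Pool m)),
        (¬ ∃ y : Fin m → ZMod 2, ∀ e ∈ F, Sat y e) → HasPerfectPseudoExp d F →
        (∃ (ε : ℝ) (nJ nA : ℕ) (μ : Fin nJ → ℝ) (S : Fin nA → Finset (Fin m))
            (f : Fin nJ → Fin nA → (Fin m → ZMod 2) → ℝ),
          0 < ε ∧ (∀ j, 0 ≤ μ j) ∧ (∀ a, (S a).card ≤ k) ∧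
          (∀ j a (y y' : Fin m → ZMod 2), (∀ i ∈ S a, y i = y' i) → f j a y = f j a y') ∧
          ∀ y : Fin m → ZMod 2, (viol F y : ℝ) - ε = ∑ j, μ j * (∑ a, f j a y) ^ 2) →
        (∀ (m' d' : ℕ) (F' : Finset (Pool m')),
          (¬ ∃ y : Fin m' → ZMod 2, ∀ e ∈ F', Sat y e) → HasPerfectPseudoExp d' F' →
          ∃ T : ℕ, ∀ (t : ℕ) (ε : ℝ), T ≤ t → 0 < ε → ∀ q r : ℕ,
            HasConeFact (fun (x : Fin m' → Fin t → ZMod 2) (w : Fin m' → Fin t) =>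
              (viol F' (fun i => x i (w i)) : ℝ) - ε) q r → t ^ φ d' ≤ q + r) ∧
        φ d ≤ k := by
  rintro ⟨φ, hφu, hφ⟩
  refine ⟨φ, hφu, fun m d k F hunsat hE ⟨ε, nJ, nA, μ, S, f, hε, hμ, hS, hf, hcert⟩ => ⟨hφ, ?_⟩⟩
  exact exactLifting_exponent_le_juntaSos φ hφ F hunsat hE hε μ hμ S hS f hf hcert

end

end Summit.PneNP.PneNP.Theorems.XorDoor
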